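import Literature.Analysis.FunctionSpaces.WeakCompactnessL1Proofs
import Literature.Analysis.FunctionSpaces.WeakL1LimitsProofs
import Literature.Analysis.FunctionSpaces.LpNormByDuality
import Mathlib.MeasureTheory.Function.SimpleFuncDenseLp
import Mathlib.Analysis.Convex.SpecificFunctions.Basic
import Mathlib.Analysis.SpecialFunctions.Pow.Asymptotics
import HarnessLib

/-!
# Weak sequential compactness of bounded sequences in `L^p`, `1 < p < ∞`, on a finite measure space

Analysis/FunctionSpaces theorem file (no definitions, no named facts). The classical statement
"a bounded sequence in `L^p(μ)`, `1 < p < ∞`, has a weakly convergent subsequence, and the norm of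
the weak limit does not exceed the inferior limit of the norms" (Brezis 2011, Thm. 3.18 with the
reflexivity of `L^p`, Thm. 4.10, and Prop. 3.5 (iii); Fonseca–Leoni 2007, §2.1.5), in the concrete
form consumed by compactness arguments for PDE (e.g. the pressures `πₖ ⇀ π` "weakly in
`L^{3/2}(0,T;L^{3/2}(B₁))`" of Bradshaw–Tsai 2019, §4.3): for real functions `fₙ` on a **finite**
measure space with `∫ |fₙ|^p ≤ C`, there are a subsequence `σ` and `g ∈ L^p` with
`∫ |g|^p ≤ lim inf ∫ |f_{σ(n)}|^p` and `∫ f_{σ(n)} ψ → ∫ g ψ` for every `ψ ∈ L^q`, `1/p + 1/q = 1`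
(`exists_subseq_tendsto_integral_mul_of_lintegral_rpow_le`).

The proof avoids the duality `(L^q)* = L^p` (not in Mathlib): a bounded sequence in `L^p` of a finite
measure space is bounded in `L¹`, equi-integrable (de la Vallée-Poussin,
`unifIntegrable_of_lintegral_superlinear_le`) and trivially tight, so the tree's **Dunford–Pettis
theorem** (`dunfordPettis_exists_subseq_holds`) extracts a subsequence converging weakly in `L¹`
(against bounded multipliers) to an integrable `g`; the bound `∫ |g|^p ≤ lim inf` is the lower
semicontinuity of the convex functional `∫ |·|^p` under weak `L¹` convergence
(`lintegral_convex_le_liminf_of_tendstoWeaklyL1_holds`); and bounded multipliers are upgraded to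
`L^q` multipliers by density of simple functions in `L^q` and Hölder's inequality with the uniform
`L^p` bound.

## References

* H. Brezis, *Functional Analysis, Sobolev Spaces and PDE* (2011), Thm. 3.18, Prop. 3.5 (iii),
  Thm. 4.10. [Brezis2011]
* I. Fonseca, G. Leoni, *Modern Methods in the Calculus of Variations: `L^p` Spaces* (2007),
  Thm. 2.54 (Dunford–Pettis). [FonsecaLeoni2007]
-/

noncomputable section

open MeasureTheory Filter Set Function
open scoped ENNReal NNReal Topology

namespace Literature.Analysis.FunctionSpaces

/-! ### Two elementary lemmas -/

/-- For `1 ≤ p` the function `x ↦ |x| ^ p` is convex on `ℝ` (composition of the convex `|·|` with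
the convex nondecreasing `t ↦ t ^ p` on `[0, ∞)`). [folklore] -/
theorem convexOn_univ_abs_rpow {p : ℝ} (hp : 1 ≤ p) : ConvexOn ℝ univ fun x : ℝ => |x| ^ p := by
  refine ⟨convex_univ, fun x _ y _ a b ha hb hab => ?_⟩
  have hp0 : 0 ≤ p := zero_le_one.trans hp
  calc |a • x + b • y| ^ p ≤ (a • |x| + b • |y|) ^ p := by
        refine Real.rpow_le_rpow (abs_nonneg _) ?_ hp0
        calc |a • x + b • y| ≤ |a • x| + |b • y| := abs_add_le _ _
          _ = a • |x| + b • |y| := by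
            simp only [smul_eq_mul, abs_mul, abs_of_nonneg ha, abs_of_nonneg hb]
    _ ≤ a • |x| ^ p + b • |y| ^ p :=
        (convexOn_rpow hp).2 (mem_Ici.2 (abs_nonneg x)) (mem_Ici.2 (abs_nonneg y)) ha hb hab

/-- `ENNReal.ofReal (|x| ^ p) = ‖x‖ₑ ^ p` for `0 ≤ p`. [folklore] -/
theorem ofReal_abs_rpow_eq_enorm_rpow (x : ℝ) {p : ℝ} (hp : 0 ≤ p) :
    ENNReal.ofReal (|x| ^ p) = ‖x‖ₑ ^ p := by
  rw [← Real.norm_eq_abs, ← ENNReal.ofReal_rpow_of_nonneg (norm_nonneg _) hp, ofReal_norm]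

/-! ### The compactness theorem -/

variable {α : Type*} [MeasurableSpace α] {μ : Measure α}

/-- The `L^p` seminorm as the `1/p`-th power of `∫⁻ ‖f‖ₑ ^ p` for a real exponent `0 < p`.
[folklore] -/
theorem eLpNorm_ofReal_eq_lintegral_rpow {p : ℝ} (hp : 0 < p) (f : α → ℝ) :
    eLpNorm f (ENNReal.ofReal p) μ = (∫⁻ x, ‖f x‖ₑ ^ p ∂μ) ^ (1 / p) := by
  rw [eLpNorm_eq_lintegral_rpow_enorm_toReal (ENNReal.ofReal_pos.2 hp).ne' ENNReal.ofReal_ne_top,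
    ENNReal.toReal_ofReal hp.le]

/-- **Weak sequential compactness of bounded sequences in `L^p`, `1 < p < ∞`, finite measure.**
Let `μ` be a finite measure, `1 < p < ∞` with conjugate exponent `q`, and `fₙ : α → ℝ`
a.e.-strongly measurable with `∫⁻ ‖fₙ‖ₑ ^ p ≤ C < ∞` for all `n`. Then there are a strictly
increasing `σ : ℕ → ℕ` and `g ∈ L^p(μ)` such that `∫⁻ ‖g‖ₑ ^ p ≤ lim inf ∫⁻ ‖f_{σ(n)}‖ₑ ^ p` and
`∫ f_{σ(n)} ψ dμ → ∫ g ψ dμ` for every `ψ ∈ L^q(μ)` (Brezis 2011, Thm. 3.18 + Thm. 4.10, with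
Prop. 3.5 (iii) for the norm of the weak limit). Proof: Dunford–Pettis in `L¹` (de la
Vallée-Poussin equi-integrability from the `L^p` bound), lower semicontinuity of the convex
functional `∫ |·|^p` under weak `L¹` convergence, and density of simple functions in `L^q` with
Hölder. [cite: Brezis2011, Thm. 3.18 with Thm. 4.10 and Prop. 3.5 (iii)] -/
theorem exists_subseq_tendsto_integral_mul_of_lintegral_rpow_le [IsFiniteMeasure μ] {p q : ℝ}
    (hpq : p.HolderConjugate q) {f : ℕ → α → ℝ} (hf : ∀ n, AEStronglyMeasurable (f n) μ)
    {C : ℝ≥0∞} (hC : C ≠ ∞) (hbd : ∀ n, ∫⁻ x, ‖f n x‖ₑ ^ p ∂μ ≤ C) :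
    ∃ σ : ℕ → ℕ, StrictMono σ ∧ ∃ g : α → ℝ, MemLp g (ENNReal.ofReal p) μ ∧
      ∫⁻ x, ‖g x‖ₑ ^ p ∂μ ≤ liminf (fun n => ∫⁻ x, ‖f (σ n) x‖ₑ ^ p ∂μ) atTop ∧
      ∀ ψ : α → ℝ, MemLp ψ (ENNReal.ofReal q) μ →
        Tendsto (fun n => ∫ x, f (σ n) x * ψ x ∂μ) atTop (𝓝 (∫ x, g x * ψ x ∂μ)) := by
  have hp1 : 1 < p := hpq.lt
  have hp0 : 0 < p := hpq.pos
  haveI hPQ : (ENNReal.ofReal p).HolderConjugate (ENNReal.ofReal q) := hpq.ennrealOfReal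
  have hp_toReal : (ENNReal.ofReal p).toReal = p := ENNReal.toReal_ofReal hp0.le
  have h1p : (1 : ℝ≥0∞) ≤ ENNReal.ofReal p := ENNReal.one_le_ofReal.2 hp1.le
  -- `‖h‖_p ≤ C^{1/p}` whenever `∫⁻ ‖h‖ₑ^p ≤ C`
  set K : ℝ≥0∞ := C ^ (1 / p) with hK
  have hKtop : K ≠ ∞ := ENNReal.rpow_ne_top_of_nonneg (by positivity) hC
  have hnorm : ∀ {h : α → ℝ}, ∫⁻ x, ‖h x‖ₑ ^ p ∂μ ≤ C → eLpNorm h (ENNReal.ofReal p) μ ≤ K :=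
    fun hh => by
      rw [eLpNorm_ofReal_eq_lintegral_rpow hp0, hK]
      exact ENNReal.rpow_le_rpow hh (by positivity)
  have hmem : ∀ {h : α → ℝ}, AEStronglyMeasurable h μ → ∫⁻ x, ‖h x‖ₑ ^ p ∂μ ≤ C →
      MemLp h (ENNReal.ofReal p) μ :=
    fun hm hh => ⟨hm, (hnorm hh).trans_lt hKtop.lt_top⟩
  have hfp : ∀ n, MemLp (f n) (ENNReal.ofReal p) μ := fun n => hmem (hf n) (hbd n)
  have hf1 : ∀ n, Integrable (f n) μ := fun n => (hfp n).integrable h1p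
  -- ## Step 1: equi-integrability, boundedness in `L¹`, tightness
  have hUI : UnifIntegrable f 1 μ := by
    refine unifIntegrable_of_lintegral_superlinear_le hf (γ := fun t => t ^ p) ?_ hC fun n => ?_
    · have e : (fun t : ℝ => t ^ p / t) =ᶠ[atTop] fun t => t ^ (p - 1) := by
        filter_upwards [eventually_gt_atTop 0] with t ht
        rw [Real.rpow_sub_one ht.ne']
      rw [tendsto_congr' e]
      exact tendsto_rpow_atTop (by linarith)
    · calc ∫⁻ x, ENNReal.ofReal (‖f n x‖ ^ p) ∂μ = ∫⁻ x, ‖f n x‖ₑ ^ p ∂μ := by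
            refine lintegral_congr fun x => ?_
            rw [Real.norm_eq_abs, ofReal_abs_rpow_eq_enorm_rpow _ hp0.le]
        _ ≤ C := hbd n
  have hUnif : UniformIntegrable f 1 μ := by
    refine ⟨hf, hUI, ?_⟩
    have hexp : 0 ≤ 1 / (1 : ℝ≥0∞).toReal - 1 / (ENNReal.ofReal p).toReal := by
      rw [ENNReal.toReal_one, hp_toReal]
      have : 1 / p ≤ 1 := by rw [div_le_one hp0]; exact hp1.le
      linarith
    set M : ℝ≥0∞ := K * μ univ ^ (1 / (1 : ℝ≥0∞).toReal - 1 / (ENNReal.ofReal p).toReal) with hM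
    have hMtop : M ≠ ∞ :=
      ENNReal.mul_ne_top hKtop (ENNReal.rpow_ne_top_of_nonneg hexp (measure_ne_top μ _))
    refine ⟨M.toNNReal, fun n => ?_⟩
    rw [ENNReal.coe_toNNReal hMtop]
    calc eLpNorm (f n) 1 μ ≤ eLpNorm (f n) (ENNReal.ofReal p) μ *
          μ univ ^ (1 / (1 : ℝ≥0∞).toReal - 1 / (ENNReal.ofReal p).toReal) :=
          eLpNorm_le_eLpNorm_mul_rpow_measure_univ h1p (hf n)
      _ ≤ M := by rw [hM]; gcongr; exact hnorm (hbd n)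
  have hUT : UnifTight f 1 μ := fun ε _ =>
    ⟨univ, measure_ne_top μ _, fun n => by simp⟩
  -- ## Step 2: Dunford–Pettis
  obtain ⟨σ, hσ, g, hg, hweak⟩ := dunfordPettis_exists_subseq_holds hUnif hUT
  have hweak' : ∀ (φ : α → ℝ) (B : ℝ), AEStronglyMeasurable φ μ → (∀ᵐ x ∂μ, |φ x| ≤ B) →
      Tendsto (fun n => ∫ x, f (σ n) x * φ x ∂μ) atTop (𝓝 (∫ x, g x * φ x ∂μ)) :=
    fun φ B hφ hB => hweak φ B hφ hB
  -- ## Step 3: lower semicontinuity of `∫ |·|^p`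
  have hlsc : ∫⁻ x, ‖g x‖ₑ ^ p ∂μ ≤ liminf (fun n => ∫⁻ x, ‖f (σ n) x‖ₑ ^ p ∂μ) atTop := by
    have hF : ConvexOn ℝ univ fun u : Unit → ℝ => |u ()| ^ p := by
      refine ⟨convex_univ, fun u _ v _ a b ha hb hab => ?_⟩
      have := (convexOn_univ_abs_rpow hp1.le).2 (mem_univ (u ())) (mem_univ (v ())) ha hb hab
      simpa using this
    have h := lintegral_convex_le_liminf_of_tendstoWeaklyL1_holds (μ := μ) (ι := Unit)
      (f := fun n _ => f (σ n)) (g := fun _ => g) (F := fun u => |u ()| ^ p) hF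
      (fun u => by positivity) (fun n _ => hf1 (σ n)) (fun _ => hg) (fun _ => hweak)
    simp only [ofReal_abs_rpow_eq_enorm_rpow _ hp0.le] at h
    exact h
  have hgC : ∫⁻ x, ‖g x‖ₑ ^ p ∂μ ≤ C :=
    hlsc.trans (liminf_le_of_frequently_le' (Frequently.of_forall fun n => hbd (σ n)))
  have hgp : MemLp g (ENNReal.ofReal p) μ := hmem hg.aestronglyMeasurable hgC
  -- ## Step 4: from bounded to `L^q` multipliers
  refine ⟨σ, hσ, g, hgp, hlsc, fun ψ hψ => ?_⟩
  rw [Metric.tendsto_atTop]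
  intro ε hε
  obtain ⟨δ, hδ0, hδ⟩ := exists_pos_mul_ofReal_le hKtop (ε := (ε / 3).toNNReal)
    (Real.toNNReal_pos.2 (by positivity))
  -- the simple approximant of `ψ` in `L^q`
  obtain ⟨s, hs, hsq⟩ := hψ.exists_simpleFunc_eLpNorm_sub_lt ENNReal.ofReal_ne_top
    (ENNReal.ofReal_pos.2 hδ0).ne'
  obtain ⟨Cs, hCs⟩ := s.exists_forall_norm_le
  have h2 : Tendsto (fun n => ∫ x, f (σ n) x * s x ∂μ) atTop (𝓝 (∫ x, g x * s x ∂μ)) :=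
    hweak' s Cs s.aestronglyMeasurable
      (Eventually.of_forall fun x => by simpa [Real.norm_eq_abs] using hCs x)
  rw [Metric.tendsto_atTop] at h2
  obtain ⟨N, hN⟩ := h2 (ε / 3) (by positivity)
  refine ⟨N, fun n hn => ?_⟩
  -- the uniform Hölder bound for the two error terms
  have hbound : ∀ {h : α → ℝ}, MemLp h (ENNReal.ofReal p) μ →
      eLpNorm h (ENNReal.ofReal p) μ ≤ K → |∫ x, h x * (ψ x - s x) ∂μ| ≤ ε / 3 := by
    intro h hh hhK
    have e1 : ‖∫ x, h x * (ψ x - s x) ∂μ‖ₑ ≤ ENNReal.ofReal (ε / 3) :=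
      calc ‖∫ x, h x * (ψ x - s x) ∂μ‖ₑ
          ≤ eLpNorm h (ENNReal.ofReal p) μ *
              eLpNorm (fun x => ψ x - s x) (ENNReal.ofReal q) μ :=
            enorm_integral_mul_le_eLpNorm_mul_eLpNorm hh.1 (hψ.1.sub s.aestronglyMeasurable)
        _ ≤ K * ENNReal.ofReal δ := mul_le_mul' hhK hs.le
        _ ≤ ENNReal.ofReal (ε / 3) := hδ
    rw [← ofReal_norm, ENNReal.ofReal_le_ofReal_iff (by positivity), Real.norm_eq_abs] at e1
    exact e1
  have i1 : Integrable (fun x => f (σ n) x * ψ x) μ := integrable_mul_of_memLp (hfp (σ n)) hψ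
  have i2 : Integrable (fun x => f (σ n) x * s x) μ := integrable_mul_of_memLp (hfp (σ n)) hsq
  have i3 : Integrable (fun x => g x * ψ x) μ := integrable_mul_of_memLp hgp hψ
  have i4 : Integrable (fun x => g x * s x) μ := integrable_mul_of_memLp hgp hsq
  have e1 : ∫ x, f (σ n) x * (ψ x - s x) ∂μ = (∫ x, f (σ n) x * ψ x ∂μ) - ∫ x, f (σ n) x * s x ∂μ := by
    rw [← integral_sub i1 i2]
    exact integral_congr_ae (Eventually.of_forall fun x => by ring)
  have e2 : ∫ x, g x * (ψ x - s x) ∂μ = (∫ x, g x * ψ x ∂μ) - ∫ x, g x * s x ∂μ := by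
    rw [← integral_sub i3 i4]
    exact integral_congr_ae (Eventually.of_forall fun x => by ring)
  have hA := hbound (hfp (σ n)) (hnorm (hbd (σ n)))
  have hB := hbound hgp (hnorm hgC)
  have hN' := hN n hn
  rw [Real.dist_eq] at hN' ⊢
  rw [e1] at hA
  rw [e2] at hB
  have key : (∫ x, f (σ n) x * ψ x ∂μ) - ∫ x, g x * ψ x ∂μ =
      ((∫ x, f (σ n) x * ψ x ∂μ) - ∫ x, f (σ n) x * s x ∂μ) +
        ((∫ x, f (σ n) x * s x ∂μ) - ∫ x, g x * s x ∂μ) -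
        ((∫ x, g x * ψ x ∂μ) - ∫ x, g x * s x ∂μ) := by ring
  rw [key]
  calc |((∫ x, f (σ n) x * ψ x ∂μ) - ∫ x, f (σ n) x * s x ∂μ) +
        ((∫ x, f (σ n) x * s x ∂μ) - ∫ x, g x * s x ∂μ) -
        ((∫ x, g x * ψ x ∂μ) - ∫ x, g x * s x ∂μ)|
      ≤ |((∫ x, f (σ n) x * ψ x ∂μ) - ∫ x, f (σ n) x * s x ∂μ) +
          ((∫ x, f (σ n) x * s x ∂μ) - ∫ x, g x * s x ∂μ)| +
          |(∫ x, g x * ψ x ∂μ) - ∫ x, g x * s x ∂μ| := abs_sub _ _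
    _ ≤ |(∫ x, f (σ n) x * ψ x ∂μ) - ∫ x, f (σ n) x * s x ∂μ| +
          |(∫ x, f (σ n) x * s x ∂μ) - ∫ x, g x * s x ∂μ| +
          |(∫ x, g x * ψ x ∂μ) - ∫ x, g x * s x ∂μ| := by
        gcongr
        exact abs_add_le _ _
    _ < ε := by linarith

/-- **Weak sequential compactness in `L^p`, with the uniform bound passing to the limit**: as in
`exists_subseq_tendsto_integral_mul_of_lintegral_rpow_le`, with the conclusion
`∫⁻ ‖g‖ₑ ^ p ≤ C` (Brezis 2011, Prop. 3.5 (iii): the norm of a weak limit does not exceed the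
`lim inf` of the norms, a fortiori the uniform bound). [cite: Brezis2011, Thm. 3.18 with Thm. 4.10 and Prop. 3.5 (iii)] -/
theorem exists_subseq_tendsto_integral_mul_of_lintegral_rpow_le' [IsFiniteMeasure μ] {p q : ℝ}
    (hpq : p.HolderConjugate q) {f : ℕ → α → ℝ} (hf : ∀ n, AEStronglyMeasurable (f n) μ)
    {C : ℝ≥0∞} (hC : C ≠ ∞) (hbd : ∀ n, ∫⁻ x, ‖f n x‖ₑ ^ p ∂μ ≤ C) :
    ∃ σ : ℕ → ℕ, StrictMono σ ∧ ∃ g : α → ℝ, MemLp g (ENNReal.ofReal p) μ ∧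
      ∫⁻ x, ‖g x‖ₑ ^ p ∂μ ≤ C ∧
      ∀ ψ : α → ℝ, MemLp ψ (ENNReal.ofReal q) μ →
        Tendsto (fun n => ∫ x, f (σ n) x * ψ x ∂μ) atTop (𝓝 (∫ x, g x * ψ x ∂μ)) := by
  obtain ⟨σ, hσ, g, hg, hlsc, hw⟩ :=
    exists_subseq_tendsto_integral_mul_of_lintegral_rpow_le hpq hf hC hbd
  exact ⟨σ, hσ, g, hg,
    hlsc.trans (liminf_le_of_frequently_le' (Frequently.of_forall fun n => hbd (σ n))), hw⟩

end Literature.Analysis.FunctionSpaces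

end
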